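import Summits.HodgeConjecture.HodgeConjecture.Theorems.F0P6bSigma2Kernel
import Summits.HodgeConjecture.HodgeConjecture.Theorems.F0P6bSigma2Quotient
import Summits.HodgeConjecture.HodgeConjecture.Theorems.F0P6bFlatQuotient
import HarnessLib
import HarnessLib.Audit.LibrarySuggestionsDenyListCruxes

/-!
# F0 · P6b — ★ RE-HOME TWIN of the sub-line «SERRE–TATE σ2», PART 3∕3: the organ E4 (reduction of the quotient) and the HEAD `stub_L4B1es_of_sigma2`

HC_CM is proved only modulo the printed citations until rung 0 closes; this twin changes no count (count-neutral ★ on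
`--supports stmt-HodgeConjecture-24832`).  Every statement and proof body below is copied VERBATIM from the crux workfile
`Cruxes/HLiu418/Lines/F0_P6b_SerreTateSigma2.lean` ED. 5 (commit 18dc629bc214, sha16 1b5126d83441851a; full history in its module docstring);
ONLY the namespace (`…Cruxes.HLiu418.F0P6bSigma2`, shared by the three parts), the sibling imports (`Lines.F0_P6b_*` ↦ `Theorems.F0P6b*`) and the
qualified sibling names are renamed, and the 868-line file is SPLIT IN THREE to meet the 400-line Theorems lint (desk F0P6b-plan (g14), LEAD «M-153u»).
Sorry-free; axioms of every theorem = [propext, Classical.choice, Quot.sound].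

Content of this part: §E4 `stub_L4B1esR_reductionOfQuotient` — the quotient `X = Y ⧸ Z` lifts `X₀` compatibly with the towers; the HEAD
`stub_L4B1es_of_sigma2` (kernel-checked junction of (U) = `F0P6bFlatQuotient.stub_L4B1u_…`-shaped hypothesis, §Q, E1, E2a, E2b, E3, E4) =
Drinfeld's essential surjectivity of the Serre–Tate functor at a square-zero∕nilpotent thickening with `p` nilpotent, consumed BY NAME by
`Theorems/F0P6bEndoLift.lean` §2.  Imports parts 1∕3, 2∕3 and the FLATQUOT twin `Theorems/F0P6bFlatQuotient.lean`.
-/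

noncomputable section

set_option autoImplicit false
set_option linter.dupNamespace false

open CategoryTheory CategoryTheory.Limits AlgebraicGeometry MonoidalCategory CartesianMonoidalCategory IsLocalRing
open scoped MonObj

namespace Summit.HodgeConjecture.HodgeConjecture.Cruxes.HLiu418.F0P6bSigma2

open Literature.AlgebraicGeometry.GroupSchemes Literature.AlgebraicGeometry.AbelianSchemes Literature.AlgebraicGeometry

/-! ## §E4 The quotient `X = Y ⧸ Z` lifts `X₀`, compatibly with the towers -/

/-- **stub E4 «REDUCTION» ([Katz1981SerreTate] proof of Thm. 1.2.1: «`K` lifts `B₀[N^ν]`, so `A` lifts `B₀⧸B₀[N^ν] ⥲ B₀ ⥲ A₀`»).**  In the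
setting of E1–E3: there is a base-change square of group schemes `G : X₀ → X` over `Spec (A⧸J) ↪ Spec A` (★ `IsBaseChangeVia`) DIVIDING
`GY ≫ π` BY `p` — `[p]_{X₀} ≫ G = GY ≫ π` on underlying schemes (modulo `J`, `Z` is `p · X₀[p²] = X₀[p]` transported by `GY`, so
`X ×_A (A⧸J) = Y₀ ⧸ Y₀[p]`, through which `[p] : Y₀ ↠ Y₀` factors as an ISOMORPHISM `θ`; `G := θ⁻¹`-square; uniqueness of the fppf quotient
by the finite flat `Y₀[p]`, descent along the finite flat surjective `π₀`) — and COMPATIBLE WITH THE TOWERS: `(i₀ n) ≫ G = c n ≫ (iX n)`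
(on points: for `b = p² b'`, `iX b = π (β b')` reduces to `π₀ (p · i₀ b') = G (p² · i₀ b') = G (i₀ b)`).  Why it might fail: only by a
mis-cut (the three displayed identities were checked on points); cost L (base change of `IsPullback` squares along `π`, ★
`AbelianSchemeOver.IsBaseChangeVia` bookkeeping of unit and multiplication).
[cite: Katz1981SerreTate, proof of Theorem 1.2.1 (§1.2, p. 142)] [cite: SGA3I, Exp. V Thm. 4.1] -/
theorem stub_L4B1esR_reductionOfQuotient :
    ∀ (p : ℕ), p.Prime → ∀ (A : Type) [CommRing A] [IsArtinianRing A] [IsLocalRing A], IsNilpotent (p : A) →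
      ∀ (J : Ideal A), J ≠ ⊤ → maximalIdeal A * J = ⊥ →
      ∀ (g : ℕ) (X₀ : AbelianSchemeOver (Spec (.of (A ⧸ J)))), X₀.IsOfRelDim g →
      ∀ (B₀ : BTGroup (Spec (.of (A ⧸ J))) p (2 * g)) (i₀ : ∀ n, B₀.G n ⟶ X₀.X), F0P6bTorsionTower.IsTorsionTower X₀ B₀ i₀ →
      ∀ (B : BTGroup (Spec (.of A)) p (2 * g)) (c : ∀ n, (B₀.G n).left ⟶ (B.G n).left),
        B₀.IsBaseChangeVia B (Spec.map (CommRingCat.ofHom (Ideal.Quotient.mk J))) c →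
      ∀ (Y : AbelianSchemeOver (Spec (.of A))), Y.IsOfRelDim g → ∀ (GY : X₀.X.left ⟶ Y.X.left),
        X₀.IsBaseChangeVia Y (Spec.map (CommRingCat.ofHom (Ideal.Quotient.mk J))) GY →
      ∀ (β : ∀ n, B.G n ⟶ Y.X), (∀ n, letI := B.grpObj n; IsMonHom (β n)) → (∀ n, B.incl n ≫ β (n + 1) = β n) →
        (∀ n, c n ≫ (β n).left = ((i₀ n) ^ p).left ≫ GY) →
      ∀ (Z : Over (Spec (.of A))) (iZ : Z ⟶ Y.X) (b : B.G 2 ⟶ Z), IsClosedImmersion iZ.left → IsFinite Z.hom → Flat Z.hom →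
        b ≫ iZ = β 2 → Flat b.left → Surjective b.left →
      ∀ (X : AbelianSchemeOver (Spec (.of A))), X.IsOfRelDim g → ∀ (π : Y.X ⟶ X.X), IsMonHom π → IsFinite π.left → Flat π.left →
        Surjective π.left → (∀ (T : Over (Spec (.of A))) (u : T ⟶ Y.X), u ≫ π = 1 ↔ ∃ v : T ⟶ Z, v ≫ iZ = u) →
      ∀ (iX : ∀ n, B.G n ⟶ X.X), F0P6bTorsionTower.IsTorsionTower X B iX →
        (∀ n, B.pMap (n + 1) ≫ B.pMap n ≫ iX n = β (n + 2) ≫ π) →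
        ∃ G : X₀.X.left ⟶ X.X.left, X₀.IsBaseChangeVia X (Spec.map (CommRingCat.ofHom (Ideal.Quotient.mk J))) G ∧
          ((𝟙 X₀.X : X₀.X ⟶ X₀.X) ^ p).left ≫ G = GY ≫ π.left ∧ ∀ n, (i₀ n).left ≫ G = c n ≫ (iX n).left := by
  -- ED. 3‴ (desk F0P6b-plan (g13)): PAID over ★ A8 `SerreTate.exists_reductionOfQuotient` ∕ `SerreTate.towerCompatibility_of_pDividingChart`
  -- (p853902, «LH5» LH5-p02 (g14)) and ★ A7 `SerreTate.kernelOfReduction` («LH10» LH10-p01 (g17)) — the desk's E4 junction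
  -- `stub_L4B1esR_of_reduction` (cand 1c901d16f319bd37, rehearsal eb911ec7b61c4825) moved here: EQUAL KERNELS ⇒ ISOMORPHIC QUOTIENTS.
  intro p hp A _ _ _ hpA J hJ hmJ g X₀ hX₀ B₀ i₀ hT₀ B c hBc Y hY GY hGY β hβ₁ hβ₂ hβ₃ Z iZ b hiZ hZf hZfl hbZ hbfl hbs X hX π hπ hπf hπfl hπs
    hker iX hiX hiXβ
  -- the reduction `π₀` of `π` (E4P, ★ A8)
  obtain ⟨π₀, hπ₀, hπ₀F, hπ₀fin, hπ₀fl, hπ₀s⟩ := SerreTate.exists_reductionOfQuotient p hp A hpA J hJ hmJ g X₀ hX₀ B₀ i₀ hT₀ B c hBc Y hY GY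
    hGY β hβ₁ hβ₂ hβ₃ Z iZ b hiZ hZf hZfl hbZ hbfl hbs X hX π hπ hπf hπfl hπs hker iX hiX hiXβ
  -- its kernel is `X₀[p]` (E4K, ★ A7)
  have hkerπ₀ := SerreTate.kernelOfReduction p hp A hpA J hJ hmJ g X₀ hX₀ B₀ i₀ hT₀ B c hBc Y hY GY hGY β hβ₁ hβ₂ hβ₃ Z iZ b hiZ hZf hZfl hbZ
    hbfl hbs X hX π hπ hπf hπfl hπs hker iX hiX hiXβ π₀ hπ₀ hπ₀F
  -- instances for ★ `exists_iso_comp_eq_of_comp_eq_one_iff`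
  haveI : IsMonHom π₀ := hπ₀
  haveI : Flat π₀.left := hπ₀fl
  haveI : Surjective π₀.left := hπ₀s
  haveI : IsFinite π₀.left := hπ₀fin
  haveI : IsAffineHom π₀.left := IsFinite.toIsAffineHom
  haveI : QuasiCompact π₀.left :=
    (quasiCompact_iff_forall_isAffineOpen (f := π₀.left)).mpr fun _ hU => (hU.preimage π₀.left).isCompact
  haveI : IsCommMonObj X₀.X := X₀.isCommMonObj_of_isLocallyNoetherian_base
  haveI : IsMonHom ((𝟙 X₀.X : X₀.X ⟶ X₀.X) ^ p) := X₀.isMonHom_mulN p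
  haveI : Flat (((𝟙 X₀.X : X₀.X ⟶ X₀.X) ^ p) : X₀.X ⟶ X₀.X).left := X₀.flat_pow_id_left_of_ne_zero hp.ne_zero
  haveI : Surjective (((𝟙 X₀.X : X₀.X ⟶ X₀.X) ^ p) : X₀.X ⟶ X₀.X).left := X₀.surjective_pow_id_left_of_ne_zero hp.ne_zero
  haveI : IsFinite (((𝟙 X₀.X : X₀.X ⟶ X₀.X) ^ p) : X₀.X ⟶ X₀.X).left := X₀.isFinite_pow_id_left_of_ne_zero hp.ne_zero
  haveI : IsAffineHom (((𝟙 X₀.X : X₀.X ⟶ X₀.X) ^ p) : X₀.X ⟶ X₀.X).left := IsFinite.toIsAffineHom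
  haveI : QuasiCompact (((𝟙 X₀.X : X₀.X ⟶ X₀.X) ^ p) : X₀.X ⟶ X₀.X).left :=
    (quasiCompact_iff_forall_isAffineOpen (f := (((𝟙 X₀.X : X₀.X ⟶ X₀.X) ^ p) : X₀.X ⟶ X₀.X).left)).mpr fun _ hU =>
      (hU.preimage _).isCompact
  -- EQUAL KERNELS ⇒ ISOMORPHIC QUOTIENTS: `e : X₀ ≅ X ×_A (A⧸J)` with `[p] ≫ e = π₀` (★ `AbelianSchemeHomDescentKernelEq`)
  obtain ⟨e, he, hemon, -⟩ := X₀.exists_iso_comp_eq_of_comp_eq_one_iff ((𝟙 X₀.X : X₀.X ⟶ X₀.X) ^ p) π₀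
    (fun T u => (hkerπ₀ T u).symm)
  haveI : IsMonHom e.hom := hemon
  -- `G := e ≫ pr₁` is a base change of group schemes: iso along `𝟙` (★ `isBaseChangeVia_id_of_isMonHom`), then the chosen base change
  -- (★ `baseChange_isBaseChangeVia`), composed (★ `IsBaseChangeVia.trans`)
  have hG : X₀.IsBaseChangeVia X (Spec.map (CommRingCat.ofHom (Ideal.Quotient.mk J)))
      (e.hom.left ≫ pullback.fst X.X.hom (Spec.map (CommRingCat.ofHom (Ideal.Quotient.mk J)))) := by
    have h1 : X₀.IsBaseChangeVia (X.baseChange (Spec.map (CommRingCat.ofHom (Ideal.Quotient.mk J)))) (𝟙 _) e.hom.left :=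
      AbelianSchemeOver.isBaseChangeVia_id_of_isMonHom X₀ (X.baseChange (Spec.map (CommRingCat.ofHom (Ideal.Quotient.mk J)))) e.hom
    have h12 := h1.trans (X.baseChange_isBaseChangeVia (Spec.map (CommRingCat.ofHom (Ideal.Quotient.mk J))))
    rwa [Category.id_comp] at h12
  have hdiv : ((𝟙 X₀.X : X₀.X ⟶ X₀.X) ^ p).left ≫ e.hom.left ≫ pullback.fst X.X.hom (Spec.map (CommRingCat.ofHom (Ideal.Quotient.mk J))) =
      GY ≫ π.left := by
    rw [← Category.assoc, ← Over.comp_left, he, hπ₀F]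
  refine ⟨e.hom.left ≫ pullback.fst X.X.hom (Spec.map (CommRingCat.ofHom (Ideal.Quotient.mk J))), hG, hdiv, fun n => ?_⟩
  -- towers (E4T, ★ A8)
  exact SerreTate.towerCompatibility_of_pDividingChart p hp A hpA J hJ hmJ g X₀ hX₀ B₀ i₀ hT₀ B c hBc Y hY GY hGY β hβ₁ hβ₂ hβ₃ Z iZ b hiZ hZf
    hZfl hbZ hbfl hbs X hX π hπ hπf hπfl hπs hker iX hiX hiXβ _ hG hdiv n

/-! ## HEAD (kernel-checked, NO sorry): the socket §2 from (U), (E1), (E2a), (E2b), (E0)+(§Q), (E3), (E4) -/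

/-- `2` is a unit in a ring in which an odd prime is nilpotent: `2 · (−k) = 1 − p` for `p = 2k + 1`. -/
theorem isUnit_two_of_isNilpotent_of_odd {A : Type} [CommRing A] {p : ℕ} (hp : p.Prime) (hp2 : p ≠ 2)
    (hpA : IsNilpotent (p : A)) : IsUnit (2 : A) := by
  obtain ⟨k, hk⟩ := hp.odd_of_ne_two hp2
  have h1p : IsUnit (1 - (p : A)) := hpA.isUnit_one_sub
  have hcalc : (1 - (p : A)) = 2 * (-(k : A)) := by rw [hk]; push_cast; ring
  rw [hcalc] at h1p
  exact isUnit_of_mul_isUnit_left h1p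

/-- **THE PARENT'S BANKED SOCKET §2 `stub_L4B1es_serreTateLift` FROM THE σ2 ORGANS (kernel-checked junction).**  Cone =
{parent §1 `stub_L4B1u_abelianLiftOfIsUnitTwo` (U), `F0P6bFlatQuotient.stub_L4B1uQ_quotientByFiniteFlatSubgroup` (§Q),
`stub_L4B1esB_betaTower` (E1), `stub_L4B1esK_kernelFiniteFlat` (E2a), `stub_L4B1esZ_imageOfFlatKernel` (E2b),
`stub_L4B1esT_torsionTowerOfQuotient` (E3), `stub_L4B1esR_reductionOfQuotient` (E4)}; ★ (E0) `AbelianSchemeOver.exists_isAffineOpen_forall_mem_of_isArtinianRing` discharges §Q's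
affine-orbit binder; `2 ∈ A^×` from `p` odd nilpotent. [cite: Katz1981SerreTate, Theorem 1.2.1 and its proof (§1.2, pp. 141–142)] -/
theorem stub_L4B1es_of_sigma2
    (hU :
      ∀ (A : Type) [CommRing A] [IsArtinianRing A] [IsLocalRing A], IsUnit (2 : A) →
        ∀ (J : Ideal A), J ≠ ⊤ → maximalIdeal A * J = ⊥ →
        ∀ (g : ℕ) (X₀ : AbelianSchemeOver (Spec (.of (A ⧸ J)))), X₀.IsOfRelDim g →
          ∃ (X : AbelianSchemeOver (Spec (.of A))) (_ : X.IsOfRelDim g) (G : X₀.X.left ⟶ X.X.left),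
            X₀.IsBaseChangeVia X (Spec.map (CommRingCat.ofHom (Ideal.Quotient.mk J))) G)
    (hQ : type_of% @F0P6bFlatQuotient.stub_L4B1uQ_quotientByFiniteFlatSubgroup)
    (hB : type_of% @stub_L4B1esB_betaTower) (hK : type_of% @stub_L4B1esK_kernelFiniteFlat)
    (hZ : type_of% @stub_L4B1esZ_imageOfFlatKernel)
    (hT : type_of% @stub_L4B1esT_torsionTowerOfQuotient) (hR : type_of% @stub_L4B1esR_reductionOfQuotient) :
    ∀ (p : ℕ), p.Prime → p ≠ 2 → ∀ (A : Type) [CommRing A] [IsArtinianRing A] [IsLocalRing A], IsNilpotent (p : A) →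
      ∀ (J : Ideal A), J ≠ ⊤ → maximalIdeal A * J = ⊥ →
      ∀ (g : ℕ) (X₀ : AbelianSchemeOver (Spec (.of (A ⧸ J)))), X₀.IsOfRelDim g →
      ∀ (B₀ : BTGroup (Spec (.of (A ⧸ J))) p (2 * g)) (i₀ : ∀ n, B₀.G n ⟶ X₀.X), F0P6bTorsionTower.IsTorsionTower X₀ B₀ i₀ →
      ∀ (B : BTGroup (Spec (.of A)) p (2 * g)) (c : ∀ n, (B₀.G n).left ⟶ (B.G n).left),
        B₀.IsBaseChangeVia B (Spec.map (CommRingCat.ofHom (Ideal.Quotient.mk J))) c →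
        ∃ (X : AbelianSchemeOver (Spec (.of A))) (_ : X.IsOfRelDim g) (G : X₀.X.left ⟶ X.X.left)
          (_ : X₀.IsBaseChangeVia X (Spec.map (CommRingCat.ofHom (Ideal.Quotient.mk J))) G)
          (iX : ∀ n, B.G n ⟶ X.X), F0P6bTorsionTower.IsTorsionTower X B iX ∧ ∀ n, (i₀ n).left ≫ G = c n ≫ (iX n).left := by
  intro p hp hp2 A _ _ _ hpA J hJ hmJ g X₀ hX₀ B₀ i₀ hi₀ B c hc
  -- (U): some abelian lift `Y` of `X₀` (`2 ∈ A^×` since `p` is odd and nilpotent)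
  have h2 : IsUnit (2 : A) := isUnit_two_of_isNilpotent_of_odd hp hp2 hpA
  obtain ⟨Y, hY, GY, hGY⟩ := hU A h2 J hJ hmJ g X₀ hX₀
  -- (E1): the canonical lift `β = «p·α⁻¹»` of the kernel embeddings into `Y`
  obtain ⟨β, hβm, hβi, hβr⟩ := hB p hp A hpA J hJ hmJ g X₀ hX₀ B₀ i₀ hi₀ B c hc Y hY GY hGY
  -- (E2a): the kernel `K` of `β 2`, a finite FLAT subgroup scheme of `B[p²]`
  obtain ⟨K, iK, hKci, hKf, hKfl, hKker⟩ := hK p hp A hpA J hJ hmJ g X₀ hX₀ B₀ i₀ hi₀ B c hc Y hY GY hGY β hβm hβi hβr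
  -- (E2b): the level-`p²` image `Z = B[p²] ⧸ K`, a finite flat subgroup scheme of `Y`
  obtain ⟨Z, iZ, b, hci, hZf, hZfl, hb, hbfl, hbs, he, hm, hn⟩ :=
    hZ p hp A hpA J hJ hmJ g X₀ hX₀ B₀ i₀ hi₀ B c hc Y hY GY hGY β hβm hβi hβr K iK hKci hKf hKfl hKker
  -- (E0) + (§Q): the quotient abelian scheme `X = Y ⧸ Z`
  obtain ⟨X, π, hπm, hπf, hπfl, hπs, hker, hrd⟩ :=
    hQ A Y (AbelianSchemeOver.exists_isAffineOpen_forall_mem_of_isArtinianRing A Y) Z iZ hci hZf hZfl he hm hn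
  have hX : X.IsOfRelDim g := hrd g hY
  -- (E3): `B = X[p^∞]`
  obtain ⟨iX, hiX, hdesc⟩ := hT p hp A hpA J hJ hmJ g X₀ hX₀ B₀ i₀ hi₀ B c hc Y hY GY hGY β hβm hβi hβr Z iZ b hci hZf hZfl
    hb hbfl hbs X hX π hπm hπf hπfl hπs hker
  -- (E4): `X` lifts `X₀`, compatibly with the towers
  obtain ⟨G, hG, -, hcomp⟩ := hR p hp A hpA J hJ hmJ g X₀ hX₀ B₀ i₀ hi₀ B c hc Y hY GY hGY β hβm hβi hβr Z iZ b hci hZf hZfl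
    hb hbfl hbs X hX π hπm hπf hπfl hπs hker iX hiX hdesc
  exact ⟨X, hX, G, hG, iX, hiX, hcomp⟩

end Summit.HodgeConjecture.HodgeConjecture.Cruxes.HLiu418.F0P6bSigma2
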